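import Summits.Ventures.CertifiedManyBodySolver.Downfold.TPrimePinnedPairRowKernelCert
import Summits.Ventures.CertifiedManyBodySolver.Certificates.HubbardSquare_LaBoxE_n1_station29o5_kernelWindowAF
import HarnessLib

/-!
# Ventures/CertifiedManyBodySolver — Theorems/CovLa214M2bItemsOfKernelPairs.lean: K1 «SegmentFanCeiling» and K2 «TransportFanCeiling» of route
# «CovLa214M2b» (stmt-Ventures-26183 / 26184) FROM KERNEL PAIR CERTIFICATES — the tier-P closers, generic in every certificate literal

HONEST FRAMING: one-sided certified stiffness-scale CEILING closers on the DOWNFOLDED La₂CuO₄ parent box «La214-E» (D-0150 M2(b); wording class (xx1):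
CONTROL / CALIBRATION); a ceiling never speaks to the presence of superconductivity or to `ρ_s = 0`; never «certified true negative»; not a `T_c` / phase / Néel
sentence; nothing about La₂CuO₄ samples. The two theorems below are CONDITIONAL on hypotheses of three kinds ONLY: (a) exporter DATA (term lists over one letter
type, ONE shared eom word list `EB` per pair) with its per-window dictionary equations, (b) per vertex ONE `decide`-class kernel inequality
`β_v ≤ lowerConst (normalize residual_v) + (μ_v 0 + μ_v 1)(1/2 − ν_v)`, (c) a handful of `norm_num`-class literal checks (multiplier signs, the law's kind
condition, the slot, the bar). NO claim node, NO `@[conjecture]`, NO number of record is used or moved; nothing is evaluated here (no exporter output exists in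
the tree at this writing); the registry words of record (edition W: K1 `0.3870869`, K2 `0.4313850`), tiers, margins and holds are UNCHANGED; «closed modulo
nodes» ≠ proved; no summit statement is proved by this file. ZERO compute, no definition, no `sorry`.

Cell `hubbard-obs` × `hubbard-downfold` (D-0154 (1)(C) La214), seat hubbard-cov-la214-unc-2 g6 (`prover-hubbard-cov-la214-unc-2-g5-0`), lineage desk.

THE CHAIN TYPED HERE (every link a tree theorem): exporter data ×2 with ONE `EB` → `SquareTTPrimePinnedPairRowT.of_kernelCerts_sos`
(`Downfold/TPrimePinnedPairRowKernelCert.lean`; through hubbard-obs-p2's `CARPolyWindow.windowIdentity_of_residTG` and this base's `…of_windowIdentities`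
p665976) → `.reprice` / `.reprice_floor` to the AF kernel window (cap `u_AF = −3039267953/5·10⁹` = `afhfCap_n1_U6_plane` at the station, band-bottom floors)
→ `.bundle_vertex` (K1, inner pair {hub′ `−3/10`, S1′ `−1/5`}) / `.bundle_interior` (K2, full-overhang pair {S2′ `−357/740`, hub′ `−3/10`}) at the kernel
K₂ box `16211390/10⁷` (p661405) → hubbard-obs-p2's edition-K-AF closers `covLa214M2b_SegmentFanCeiling_of_afWindow` / `covLa214M2b_TransportFanCeiling_of_afWindow_full`
(`Certificates/HubbardSquare_LaBoxE_n1_station29o5_kernelWindowAF.lean`). The rung leaf follows by the route's glue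
`Theses.CovLa214M2b.closes ⟨K1⟩ ⟨K2⟩ : La214M2b_StiffnessBoxCeiling` (three vertex certificates hub′ / S1′ / S2′ in their Ward-free `u′` editions = three
kernel evaluations + dictionaries).

References: T. Koma, H. Tasaki, J. Stat. Phys. 76 (1994) 745 §1 [KomaTasaki1994]; D. J. Scalapino, S. R. White, S.-C. Zhang, PRB 47 (1993) 7995 §II
[ScalapinoWhiteZhang1993]; J. Wang et al., PRX 14 (2024) 031006 §III [WangEtAl2024]; S. Boyd, L. Vandenberghe, *Convex Optimization* (2004) §5.9
[BoydVandenberghe2004]; C. Jansson, D. Chaykin, C. Keil, SIAM J. Numer. Anal. 46 (2008) 180 [JanssonChaykinKeil2008].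
-/

noncomputable section

namespace Summit.Ventures.CertifiedManyBodySolver.Theorems

open Summit.Ventures.CertifiedManyBodySolver.Theses.CovLa214M2b
open Summit.Ventures.CertifiedManyBodySolver.Downfold Summit.Ventures.CertifiedManyBodySolver.Certificates
open Summit.Ventures.CertifiedManyBodySolver.Observables
open Summit.Ventures.CertifiedQuantumChemistry Summit.Ventures.CertifiedQuantumChemistry.CARPoly
open Summit.Ventures.CertifiedManyBodySolver.CARPolyWindow
open Literature.MathematicalPhysics.QuantumLattice Literature.MathematicalPhysics.QuantumLattice.ThermodynamicLimit
open Literature.Probability.LatticeModels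
open Matrix Filter Topology HubbardWave0
open scoped BigOperators ComplexOrder

/-! ## §1 K1 «SegmentFanCeiling» from the kernel pair {hub′ at `−3/10`, S1′ at `−1/5`} (edition K-AF, VERTEX kind) -/

section K1

variable {α β : Type*} [LinearOrder α]

/-- **K1 «SegmentFanCeiling» (stmt-Ventures-26183) FROM TWO SYNTACTIC VERTEX CERTIFICATES WITH ONE SHARED EOM WORD LIST** — the inner pair
{A = hub′ at `t′ = −3/10`, B = S1′ at `t′ = −1/5`} of the La214-E station `(U, n) = (29/5, 1)`, OWN f-sum objectives `s ↦ −X₀(s, 29/5)`, ANY caps/floors/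
multipliers the two certificates carry (`cap_v, fl_v, κ_v, κ_v'`, `κ ≥ 0`) and ANY rational bounds `β_v` below the two kernel prices
`lowerConst R_v + (μ_v 0 + μ_v 1)(1/2 − ν_v)`; re-priced to the AF kernel window (cap `u_AF = −3039267953/5·10⁹`, band-bottom floors `−14/5 ∣ −16/5`), VERTEX kind
of the boxdual law at the kernel K₂ box (`L ≤ |β″_B − β″_A|`), slot `F ≤ min β″_A β″_B` with `−F ≤ 4364687/10⁷`. Every hypothesis is either exporter DATA with its
dictionary equations, a `decide`-class kernel inequality (`hβ_v`), or a `norm_num`-class literal check (`hL`, `hF`, `hbar`). [cite: KomaTasaki1994, §1]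
[cite: WangEtAl2024, §III] [cite: BoydVandenberghe2004, §5.9] -/
theorem covLa214M2b_SegmentFanCeiling_of_kernelPair_hubS1
    {Λ : Finset (Site 2)} (hΛ : Λ ⊆ box 2 7) (h8 : thicken Λ 1 ⊆ box 2 7)
    (h0 : thicken ({0} : Finset (Site 2)) 1 ⊆ box 2 7) (hz : (0 : Site 2) ∈ box 2 7)
    (d : α → Orb (PolySite (box 2 7))) (hd : Function.Injective d) (enc : α → ℕ) (Bkey : ℕ)
    (dΛ : β → Orb (PolySite Λ)) (f : β → α) (hf : ∀ b, d (f b) = Orb.embMap (PolySite.incl hΛ) (dΛ b))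
    (sp : α → Fin 2) (hsp : ∀ a, (ofLex (d a)).2 = sp a)
    (o : Fin 2 → α) (ho : ∀ σ, d (o σ) = orb (PolySite.pt 0 hz) σ)
    (EB : List (Terms β))
    -- vertex A = hub′ at −3/10
    (THA : Terms α) (hHA : termOp d THA = (hubbardTTPrimeFermionInteraction 1 (((-3 / 10 : ℚ)) : ℝ) (((29 / 5 : ℚ)) : ℝ)).localHamiltonian (box 2 7))
    (TEA : Terms α) (hEA : termOp d TEA =
      fermionEmbed (PolySite.incl h0) ((hubbardTTPrimeFermionInteraction 1 (((-3 / 10 : ℚ)) : ℝ) (((29 / 5 : ℚ)) : ℝ)).meanEnergyObs 1))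
    (TXA : Terms α) (hXA : termOp d TXA = -oddMomentObsTT (-3 / 10) (29 / 5) 0) (μA : Fin 2 → ℚ) (νA κA capA κA' flA : ℚ)
    (KA : ℕ) (QA : List (Terms α))
    {nSA : ℕ} (γA : Fin nSA → DihedralGroup 4) (wvA : Fin nSA → Site 2) (hshA : ∀ l, d4ShiftSet (γA l) (wvA l) Λ ⊆ box 2 7)
    (gA : Fin nSA → β → α)
    (hgA : ∀ l b, d (gA l b) = Orb.embMap (PolySite.incl (hshA l)) (Orb.embMap (PolySite.d4Emb (γA l) (wvA l) Λ) (dΛ b)))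
    (SYA : Fin nSA → Terms β) (CWA : Terms α) (hcwA : ∀ wc ∈ CWA, chargeW wc.1 ≠ 0 ∨ spinChargeW sp wc.1 ≠ 0) (AVA : List (Terms α))
    {RA : CARPoly.Poly α}
    (hRA : CARPoly.normalize enc Bkey (residT TXA μA νA o κA capA κA' flA TEA KA QA THA f EB gA SYA CWA AVA) = RA)
    (βA : ℚ) (hβA : βA ≤ lowerConst RA + (μA 0 + μA 1) * (1 / 2 - νA))
    -- vertex B = S1′ at −1/5
    (THB : Terms α) (hHB : termOp d THB = (hubbardTTPrimeFermionInteraction 1 (((-1 / 5 : ℚ)) : ℝ) (((29 / 5 : ℚ)) : ℝ)).localHamiltonian (box 2 7))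
    (TEB : Terms α) (hEB : termOp d TEB =
      fermionEmbed (PolySite.incl h0) ((hubbardTTPrimeFermionInteraction 1 (((-1 / 5 : ℚ)) : ℝ) (((29 / 5 : ℚ)) : ℝ)).meanEnergyObs 1))
    (TXB : Terms α) (hXB : termOp d TXB = -oddMomentObsTT (-1 / 5) (29 / 5) 0) (μB : Fin 2 → ℚ) (νB κB capB κB' flB : ℚ)
    (KB : ℕ) (QB : List (Terms α))
    {nSB : ℕ} (γB : Fin nSB → DihedralGroup 4) (wvB : Fin nSB → Site 2) (hshB : ∀ l, d4ShiftSet (γB l) (wvB l) Λ ⊆ box 2 7)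
    (gB : Fin nSB → β → α)
    (hgB : ∀ l b, d (gB l b) = Orb.embMap (PolySite.incl (hshB l)) (Orb.embMap (PolySite.d4Emb (γB l) (wvB l) Λ) (dΛ b)))
    (SYB : Fin nSB → Terms β) (CWB : Terms α) (hcwB : ∀ wc ∈ CWB, chargeW wc.1 ≠ 0 ∨ spinChargeW sp wc.1 ≠ 0) (AVB : List (Terms α))
    {RB : CARPoly.Poly α}
    (hRB : CARPoly.normalize enc Bkey (residT TXB μB νB o κB capB κB' flB TEB KB QB THB f EB gB SYB CWB AVB) = RB)
    (βB : ℚ) (hβB : βB ≤ lowerConst RB + (μB 0 + μB 1) * (1 / 2 - νB))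
    -- literal checks (norm_num-class once the literals are known)
    (hκA : 0 ≤ κA) (hκA' : 0 ≤ κA') (hκB : 0 ≤ κB) (hκB' : 0 ≤ κB')
    (F : ℚ)
    (hL : (1 / 10 : ℝ) * |((((κB - κA) - (κB' - κA') : ℚ)) : ℝ)| * (((16211390 / 10000000 : ℚ)) : ℝ) -
        ((((κB' - κA') * (-((-16 / 5 : ℚ) - (-14 / 5))) : ℚ)) : ℝ) ≤
      |(((βB - κB * (-3039267953 / 5000000000 - capB) - κB' * (flB - (-16 / 5)) : ℚ)) : ℝ) -
        (((βA - κA * (-3039267953 / 5000000000 - capA) - κA' * (flA - (-14 / 5)) : ℚ)) : ℝ)|)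
    (hF : F ≤ min (βA - κA * (-3039267953 / 5000000000 - capA) - κA' * (flA - (-14 / 5)))
      (βB - κB * (-3039267953 / 5000000000 - capB) - κB' * (flB - (-16 / 5))))
    (hbar : -F ≤ 4364687 / 10000000) :
    SegmentFanCeiling := by
  -- (1) the pair shape from the two kernel certificates
  have hXA' : termOp d TXA = (fun s : ℝ => -oddMomentObsTT s (29 / 5) 0) (((-3 / 10 : ℚ)) : ℝ) := by
    rw [hXA]; push_cast; ring_nf
  have hXB' : termOp d TXB = (fun s : ℝ => -oddMomentObsTT s (29 / 5) 0) (((-1 / 5 : ℚ)) : ℝ) := by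
    rw [hXB]; push_cast; ring_nf
  have hp := SquareTTPrimePinnedPairRowT.of_kernelCerts_sos (29 / 5) (by norm_num) 1 (by norm_num) (by norm_num) (-3 / 10) (-1 / 5)
    hΛ h8 h0 hz d hd enc Bkey dΛ f hf sp hsp o ho (fun s : ℝ => -oddMomentObsTT s (29 / 5) 0) EB
    THA hHA TEA hEA TXA hXA' μA νA κA capA κA' flA KA QA γA wvA hshA gA hgA SYA CWA hcwA AVA hRA hβA
    THB hHB TEB hEB TXB hXB' μB νB κB capB κB' flB KB QB γB wvB hshB gB hgB SYB CWB hcwB AVB hRB hβB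
  have e1 : (((29 / 5 : ℚ)) : ℝ) = 29 / 5 := by norm_num
  have e2 : (((1 : ℚ)) : ℝ) = 1 := by norm_num
  have e3 : (((-3 / 10 : ℚ)) : ℝ) = -3 / 10 := by norm_num
  have e4 : (((-1 / 5 : ℚ)) : ℝ) = -1 / 5 := by norm_num
  rw [e1, e2, e3, e4] at hp
  -- (2) re-price to the AF kernel window and take the VERTEX kind of the law at the kernel K₂ box
  have h1 := (hp.reprice (-3039267953 / 5000000000) (-3039267953 / 5000000000)).reprice_floor (-14 / 5) (-16 / 5)
  have hrow : TPrimeBundleOrbitLowerRow (29 / 5) 1 (-3 / 10) (-1 / 5) (-14 / 5) (-16 / 5) (-3039267953 / 5000000000) F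
      (fun s => -oddMomentObsTT s (29 / 5) 0) :=
    h1.bundle_vertex (by norm_num) (by norm_num) (by norm_num) hκA hκA' hκB hκB' le_rfl le_rfl
      (tPrimeObj_chord_negOddMomentTT (29 / 5) (-3 / 10) (-1 / 5)) rfl (by
        have e : ((-1 / 5 : ℝ) - (-3 / 10)) = 1 / 10 := by norm_num
        rw [e]; exact hL) hF
  -- (3) the K1 closer at the AF window
  exact covLa214M2b_SegmentFanCeiling_of_afWindow F hbar hrow

end K1

/-! ## §2 K2 «TransportFanCeiling» from the kernel pair {S2′ at `−357/740`, hub′ at `−3/10`} (edition K-AF, INTERIOR kind) -/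

section K2

variable {α β : Type*} [LinearOrder α]

/-- **K2 «TransportFanCeiling» (stmt-Ventures-26184) FROM TWO SYNTACTIC VERTEX CERTIFICATES WITH ONE SHARED EOM WORD LIST** — the full-overhang pair
{A = S2′ at `t′ = −357/740`, B = hub′ at `t′ = −3/10`} of the La214-E station `(29/5, 1)`, CORNER objective `−X₀(−3/10, 29/5)` at both vertices, ANY caps/floors/
multipliers (`κ ≥ 0`) and ANY rational `β_v` below the two kernel prices; re-priced to the AF kernel window (cap `u_AF`, band-bottom floors `−383/185 ∣ −14/5`),
INTERIOR kind of the boxdual law at the kernel K₂ box (`0 < L`, slot `F ≤ β″_A − (L − (β″_B − β″_A))²/(4L)`) with `−F ≤ 4364687/10⁷`; `L` is supplied as a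
rational with its defining equation (`hLdef`, `norm_num`-class). [cite: KomaTasaki1994, §1] [cite: WangEtAl2024, §III] [cite: BoydVandenberghe2004, §5.9] -/
theorem covLa214M2b_TransportFanCeiling_of_kernelPair_S2hub
    {Λ : Finset (Site 2)} (hΛ : Λ ⊆ box 2 7) (h8 : thicken Λ 1 ⊆ box 2 7)
    (h0 : thicken ({0} : Finset (Site 2)) 1 ⊆ box 2 7) (hz : (0 : Site 2) ∈ box 2 7)
    (d : α → Orb (PolySite (box 2 7))) (hd : Function.Injective d) (enc : α → ℕ) (Bkey : ℕ)
    (dΛ : β → Orb (PolySite Λ)) (f : β → α) (hf : ∀ b, d (f b) = Orb.embMap (PolySite.incl hΛ) (dΛ b))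
    (sp : α → Fin 2) (hsp : ∀ a, (ofLex (d a)).2 = sp a)
    (o : Fin 2 → α) (ho : ∀ σ, d (o σ) = orb (PolySite.pt 0 hz) σ)
    (EB : List (Terms β))
    -- vertex A = S2′ at −357/740 (corner objective)
    (THA : Terms α)
    (hHA : termOp d THA = (hubbardTTPrimeFermionInteraction 1 (((-(357 / 740) : ℚ)) : ℝ) (((29 / 5 : ℚ)) : ℝ)).localHamiltonian (box 2 7))
    (TEA : Terms α) (hEA : termOp d TEA =
      fermionEmbed (PolySite.incl h0) ((hubbardTTPrimeFermionInteraction 1 (((-(357 / 740) : ℚ)) : ℝ) (((29 / 5 : ℚ)) : ℝ)).meanEnergyObs 1))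
    (TXA : Terms α) (hXA : termOp d TXA = -oddMomentObsTT (-3 / 10) (29 / 5) 0) (μA : Fin 2 → ℚ) (νA κA capA κA' flA : ℚ)
    (KA : ℕ) (QA : List (Terms α))
    {nSA : ℕ} (γA : Fin nSA → DihedralGroup 4) (wvA : Fin nSA → Site 2) (hshA : ∀ l, d4ShiftSet (γA l) (wvA l) Λ ⊆ box 2 7)
    (gA : Fin nSA → β → α)
    (hgA : ∀ l b, d (gA l b) = Orb.embMap (PolySite.incl (hshA l)) (Orb.embMap (PolySite.d4Emb (γA l) (wvA l) Λ) (dΛ b)))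
    (SYA : Fin nSA → Terms β) (CWA : Terms α) (hcwA : ∀ wc ∈ CWA, chargeW wc.1 ≠ 0 ∨ spinChargeW sp wc.1 ≠ 0) (AVA : List (Terms α))
    {RA : CARPoly.Poly α}
    (hRA : CARPoly.normalize enc Bkey (residT TXA μA νA o κA capA κA' flA TEA KA QA THA f EB gA SYA CWA AVA) = RA)
    (βA : ℚ) (hβA : βA ≤ lowerConst RA + (μA 0 + μA 1) * (1 / 2 - νA))
    -- vertex B = hub′ at −3/10 (its own objective = the corner objective)
    (THB : Terms α) (hHB : termOp d THB = (hubbardTTPrimeFermionInteraction 1 (((-3 / 10 : ℚ)) : ℝ) (((29 / 5 : ℚ)) : ℝ)).localHamiltonian (box 2 7))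
    (TEB : Terms α) (hEB : termOp d TEB =
      fermionEmbed (PolySite.incl h0) ((hubbardTTPrimeFermionInteraction 1 (((-3 / 10 : ℚ)) : ℝ) (((29 / 5 : ℚ)) : ℝ)).meanEnergyObs 1))
    (TXB : Terms α) (hXB : termOp d TXB = -oddMomentObsTT (-3 / 10) (29 / 5) 0) (μB : Fin 2 → ℚ) (νB κB capB κB' flB : ℚ)
    (KB : ℕ) (QB : List (Terms α))
    {nSB : ℕ} (γB : Fin nSB → DihedralGroup 4) (wvB : Fin nSB → Site 2) (hshB : ∀ l, d4ShiftSet (γB l) (wvB l) Λ ⊆ box 2 7)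
    (gB : Fin nSB → β → α)
    (hgB : ∀ l b, d (gB l b) = Orb.embMap (PolySite.incl (hshB l)) (Orb.embMap (PolySite.d4Emb (γB l) (wvB l) Λ) (dΛ b)))
    (SYB : Fin nSB → Terms β) (CWB : Terms α) (hcwB : ∀ wc ∈ CWB, chargeW wc.1 ≠ 0 ∨ spinChargeW sp wc.1 ≠ 0) (AVB : List (Terms α))
    {RB : CARPoly.Poly α}
    (hRB : CARPoly.normalize enc Bkey (residT TXB μB νB o κB capB κB' flB TEB KB QB THB f EB gB SYB CWB AVB) = RB)
    (βB : ℚ) (hβB : βB ≤ lowerConst RB + (μB 0 + μB 1) * (1 / 2 - νB))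
    -- literal checks (norm_num-class once the literals are known)
    (hκA : 0 ≤ κA) (hκA' : 0 ≤ κA') (hκB : 0 ≤ κB) (hκB' : 0 ≤ κB')
    (F L : ℚ)
    (hLdef : ((L : ℚ) : ℝ) = ((-3 / 10 : ℝ) - (-(357 / 740))) * |((((κB - κA) - (κB' - κA') : ℚ)) : ℝ)| * (((16211390 / 10000000 : ℚ)) : ℝ) -
        ((((κB' - κA') * (-((-14 / 5 : ℚ) - (-383 / 185))) : ℚ)) : ℝ))
    (hL : 0 < L)
    (hF : ((F : ℚ) : ℝ) ≤ (((βA - κA * (-3039267953 / 5000000000 - capA) - κA' * (flA - (-383 / 185)) : ℚ)) : ℝ) -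
        (((L : ℚ) : ℝ) - ((((βB - κB * (-3039267953 / 5000000000 - capB) - κB' * (flB - (-14 / 5)) : ℚ)) : ℝ) -
          (((βA - κA * (-3039267953 / 5000000000 - capA) - κA' * (flA - (-383 / 185)) : ℚ)) : ℝ))) ^ 2 / (4 * ((L : ℚ) : ℝ)))
    (hbar : -F ≤ 4364687 / 10000000) :
    TransportFanCeiling := by
  -- (1) the pair shape from the two kernel certificates (constant objective family)
  have hp := SquareTTPrimePinnedPairRowT.of_kernelCerts_sos (29 / 5) (by norm_num) 1 (by norm_num) (by norm_num) (-(357 / 740)) (-3 / 10)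
    hΛ h8 h0 hz d hd enc Bkey dΛ f hf sp hsp o ho (fun _ : ℝ => -oddMomentObsTT (-3 / 10) (29 / 5) 0) EB
    THA hHA TEA hEA TXA hXA μA νA κA capA κA' flA KA QA γA wvA hshA gA hgA SYA CWA hcwA AVA hRA hβA
    THB hHB TEB hEB TXB hXB μB νB κB capB κB' flB KB QB γB wvB hshB gB hgB SYB CWB hcwB AVB hRB hβB
  have e1 : (((29 / 5 : ℚ)) : ℝ) = 29 / 5 := by norm_num
  have e2 : (((1 : ℚ)) : ℝ) = 1 := by norm_num
  have e3 : (((-(357 / 740) : ℚ)) : ℝ) = -(357 / 740) := by norm_num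
  have e4 : (((-3 / 10 : ℚ)) : ℝ) = -3 / 10 := by norm_num
  rw [e1, e2, e3, e4] at hp
  -- (2) re-price to the AF kernel window and take the INTERIOR kind of the law at the kernel K₂ box
  have h1 := (hp.reprice (-3039267953 / 5000000000) (-3039267953 / 5000000000)).reprice_floor (-383 / 185) (-14 / 5)
  have hLpos : (0 : ℝ) < ((L : ℚ) : ℝ) := by exact_mod_cast hL
  have hrow : TPrimeBundleOrbitLowerRow (29 / 5) 1 (-(357 / 740)) (-3 / 10) (-383 / 185) (-14 / 5) (-3039267953 / 5000000000) F
      (fun _ => -oddMomentObsTT (-3 / 10) (29 / 5) 0) :=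
    h1.bundle_interior (by norm_num) (by norm_num) (by norm_num) hκA hκA' hκB hκB' le_rfl le_rfl
      (tPrimeObj_chord_const (-oddMomentObsTT (-3 / 10) (29 / 5) 0) (-(357 / 740)) (-3 / 10)) hLdef hLpos hF
  -- (3) the K2 closer at the AF window
  exact covLa214M2b_TransportFanCeiling_of_afWindow_full F hbar hrow

end K2

/-! ## §3 THE RUNG LEAF from the kernel TRIPLE {hub′, S1′, S2′} with ONE shared eom word list -/

section Leaf

variable {α β : Type*} [LinearOrder α]

/-- **THE MO-S2 RUNG LEAF `La214M2b_StiffnessBoxCeiling` FROM THREE SYNTACTIC VERTEX CERTIFICATES {hub′ `−3/10`, S1′ `−1/5`, S2′ `−357/740`} WITH ONE SHARED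
EOM WORD LIST** (the hub's; both spokes pinned to it): K1 from the pair {hub′, S1′} (`covLa214M2b_SegmentFanCeiling_of_kernelPair_hubS1`), K2 from the pair
{S2′, hub′} (`covLa214M2b_TransportFanCeiling_of_kernelPair_S2hub`), glued by the route's `Theses.CovLa214M2b.closes`. Hypotheses: exporter data ×3 with
dictionaries, THREE decide-class kernel facts (one per vertex; the hub's serves both pairs), and the norm_num-class literal checks of both pairs. Instantiated by
NO certificate of record; the CORE-class U4c objects (hubbard-cov-la214-sdp-1, hubbard-obs STATUS 2026-08-28T21:11:33Z) are the intended first inputs; EXT5-L⁺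
objects of record would enter the same theorem. [cite: KomaTasaki1994, §1] [cite: ScalapinoWhiteZhang1993, §II] [cite: WangEtAl2024, §III] -/
theorem La214M2b_StiffnessBoxCeiling_of_kernelTriple
    {Λ : Finset (Site 2)} (hΛ : Λ ⊆ box 2 7) (h8 : thicken Λ 1 ⊆ box 2 7)
    (h0 : thicken ({0} : Finset (Site 2)) 1 ⊆ box 2 7) (hz : (0 : Site 2) ∈ box 2 7)
    (d : α → Orb (PolySite (box 2 7))) (hd : Function.Injective d) (enc : α → ℕ) (Bkey : ℕ)
    (dΛ : β → Orb (PolySite Λ)) (f : β → α) (hf : ∀ b, d (f b) = Orb.embMap (PolySite.incl hΛ) (dΛ b))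
    (sp : α → Fin 2) (hsp : ∀ a, (ofLex (d a)).2 = sp a)
    (o : Fin 2 → α) (ho : ∀ σ, d (o σ) = orb (PolySite.pt 0 hz) σ)
    (EB : List (Terms β))
    -- hub′ at −3/10 (own objective = corner objective)
    (THh : Terms α) (hHh : termOp d THh = (hubbardTTPrimeFermionInteraction 1 (((-3 / 10 : ℚ)) : ℝ) (((29 / 5 : ℚ)) : ℝ)).localHamiltonian (box 2 7))
    (TEh : Terms α) (hEh : termOp d TEh =
      fermionEmbed (PolySite.incl h0) ((hubbardTTPrimeFermionInteraction 1 (((-3 / 10 : ℚ)) : ℝ) (((29 / 5 : ℚ)) : ℝ)).meanEnergyObs 1))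
    (TXh : Terms α) (hXh : termOp d TXh = -oddMomentObsTT (-3 / 10) (29 / 5) 0) (μh : Fin 2 → ℚ) (νh κh caph κh' flh : ℚ)
    (Kh : ℕ) (Qh : List (Terms α))
    {nSh : ℕ} (γh : Fin nSh → DihedralGroup 4) (wvh : Fin nSh → Site 2) (hshh : ∀ l, d4ShiftSet (γh l) (wvh l) Λ ⊆ box 2 7)
    (gh : Fin nSh → β → α)
    (hgh : ∀ l b, d (gh l b) = Orb.embMap (PolySite.incl (hshh l)) (Orb.embMap (PolySite.d4Emb (γh l) (wvh l) Λ) (dΛ b)))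
    (SYh : Fin nSh → Terms β) (CWh : Terms α) (hcwh : ∀ wc ∈ CWh, chargeW wc.1 ≠ 0 ∨ spinChargeW sp wc.1 ≠ 0) (AVh : List (Terms α))
    {Rh : CARPoly.Poly α}
    (hRh : CARPoly.normalize enc Bkey (residT TXh μh νh o κh caph κh' flh TEh Kh Qh THh f EB gh SYh CWh AVh) = Rh)
    (βh : ℚ) (hβh : βh ≤ lowerConst Rh + (μh 0 + μh 1) * (1 / 2 - νh))
    -- S1′ at −1/5 (own objective)
    (THs : Terms α) (hHs : termOp d THs = (hubbardTTPrimeFermionInteraction 1 (((-1 / 5 : ℚ)) : ℝ) (((29 / 5 : ℚ)) : ℝ)).localHamiltonian (box 2 7))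
    (TEs : Terms α) (hEs : termOp d TEs =
      fermionEmbed (PolySite.incl h0) ((hubbardTTPrimeFermionInteraction 1 (((-1 / 5 : ℚ)) : ℝ) (((29 / 5 : ℚ)) : ℝ)).meanEnergyObs 1))
    (TXs : Terms α) (hXs : termOp d TXs = -oddMomentObsTT (-1 / 5) (29 / 5) 0) (μs : Fin 2 → ℚ) (νs κs caps κs' fls : ℚ)
    (Ks : ℕ) (Qs : List (Terms α))
    {nSs : ℕ} (γs : Fin nSs → DihedralGroup 4) (wvs : Fin nSs → Site 2) (hshs : ∀ l, d4ShiftSet (γs l) (wvs l) Λ ⊆ box 2 7)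
    (gs : Fin nSs → β → α)
    (hgs : ∀ l b, d (gs l b) = Orb.embMap (PolySite.incl (hshs l)) (Orb.embMap (PolySite.d4Emb (γs l) (wvs l) Λ) (dΛ b)))
    (SYs : Fin nSs → Terms β) (CWs : Terms α) (hcws : ∀ wc ∈ CWs, chargeW wc.1 ≠ 0 ∨ spinChargeW sp wc.1 ≠ 0) (AVs : List (Terms α))
    {Rs : CARPoly.Poly α}
    (hRs : CARPoly.normalize enc Bkey (residT TXs μs νs o κs caps κs' fls TEs Ks Qs THs f EB gs SYs CWs AVs) = Rs)
    (βs : ℚ) (hβs : βs ≤ lowerConst Rs + (μs 0 + μs 1) * (1 / 2 - νs))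
    -- S2′ at −357/740 (corner objective)
    (THo : Terms α)
    (hHo : termOp d THo = (hubbardTTPrimeFermionInteraction 1 (((-(357 / 740) : ℚ)) : ℝ) (((29 / 5 : ℚ)) : ℝ)).localHamiltonian (box 2 7))
    (TEo : Terms α) (hEo : termOp d TEo =
      fermionEmbed (PolySite.incl h0) ((hubbardTTPrimeFermionInteraction 1 (((-(357 / 740) : ℚ)) : ℝ) (((29 / 5 : ℚ)) : ℝ)).meanEnergyObs 1))
    (TXo : Terms α) (hXo : termOp d TXo = -oddMomentObsTT (-3 / 10) (29 / 5) 0) (μo : Fin 2 → ℚ) (νo κo capo κo' flo : ℚ)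
    (Ko : ℕ) (Qo : List (Terms α))
    {nSo : ℕ} (γo : Fin nSo → DihedralGroup 4) (wvo : Fin nSo → Site 2) (hsho : ∀ l, d4ShiftSet (γo l) (wvo l) Λ ⊆ box 2 7)
    (go : Fin nSo → β → α)
    (hgo : ∀ l b, d (go l b) = Orb.embMap (PolySite.incl (hsho l)) (Orb.embMap (PolySite.d4Emb (γo l) (wvo l) Λ) (dΛ b)))
    (SYo : Fin nSo → Terms β) (CWo : Terms α) (hcwo : ∀ wc ∈ CWo, chargeW wc.1 ≠ 0 ∨ spinChargeW sp wc.1 ≠ 0) (AVo : List (Terms α))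
    {Ro : CARPoly.Poly α}
    (hRo : CARPoly.normalize enc Bkey (residT TXo μo νo o κo capo κo' flo TEo Ko Qo THo f EB go SYo CWo AVo) = Ro)
    (βo : ℚ) (hβo : βo ≤ lowerConst Ro + (μo 0 + μo 1) * (1 / 2 - νo))
    -- literal checks: signs
    (hκh : 0 ≤ κh) (hκh' : 0 ≤ κh') (hκs : 0 ≤ κs) (hκs' : 0 ≤ κs') (hκo : 0 ≤ κo) (hκo' : 0 ≤ κo')
    -- literal checks: K1 pair {A = hub′, B = S1′}, VERTEX kind
    (Fi : ℚ)
    (hLi : (1 / 10 : ℝ) * |((((κs - κh) - (κs' - κh') : ℚ)) : ℝ)| * (((16211390 / 10000000 : ℚ)) : ℝ) -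
        ((((κs' - κh') * (-((-16 / 5 : ℚ) - (-14 / 5))) : ℚ)) : ℝ) ≤
      |(((βs - κs * (-3039267953 / 5000000000 - caps) - κs' * (fls - (-16 / 5)) : ℚ)) : ℝ) -
        (((βh - κh * (-3039267953 / 5000000000 - caph) - κh' * (flh - (-14 / 5)) : ℚ)) : ℝ)|)
    (hFi : Fi ≤ min (βh - κh * (-3039267953 / 5000000000 - caph) - κh' * (flh - (-14 / 5)))
      (βs - κs * (-3039267953 / 5000000000 - caps) - κs' * (fls - (-16 / 5))))
    (hbari : -Fi ≤ 4364687 / 10000000)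
    -- literal checks: K2 pair {A = S2′, B = hub′}, INTERIOR kind
    (Fo Lo : ℚ)
    (hLodef : ((Lo : ℚ) : ℝ) = ((-3 / 10 : ℝ) - (-(357 / 740))) * |((((κh - κo) - (κh' - κo') : ℚ)) : ℝ)| * (((16211390 / 10000000 : ℚ)) : ℝ) -
        ((((κh' - κo') * (-((-14 / 5 : ℚ) - (-383 / 185))) : ℚ)) : ℝ))
    (hLo : 0 < Lo)
    (hFo : ((Fo : ℚ) : ℝ) ≤ (((βo - κo * (-3039267953 / 5000000000 - capo) - κo' * (flo - (-383 / 185)) : ℚ)) : ℝ) -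
        (((Lo : ℚ) : ℝ) - ((((βh - κh * (-3039267953 / 5000000000 - caph) - κh' * (flh - (-14 / 5)) : ℚ)) : ℝ) -
          (((βo - κo * (-3039267953 / 5000000000 - capo) - κo' * (flo - (-383 / 185)) : ℚ)) : ℝ))) ^ 2 / (4 * ((Lo : ℚ) : ℝ)))
    (hbaro : -Fo ≤ 4364687 / 10000000) :
    La214M2b_StiffnessBoxCeiling :=
  Summit.Ventures.CertifiedManyBodySolver.Theses.CovLa214M2b.closes
    (covLa214M2b_SegmentFanCeiling_of_kernelPair_hubS1 hΛ h8 h0 hz d hd enc Bkey dΛ f hf sp hsp o ho EB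
      THh hHh TEh hEh TXh hXh μh νh κh caph κh' flh Kh Qh γh wvh hshh gh hgh SYh CWh hcwh AVh hRh βh hβh
      THs hHs TEs hEs TXs hXs μs νs κs caps κs' fls Ks Qs γs wvs hshs gs hgs SYs CWs hcws AVs hRs βs hβs
      hκh hκh' hκs hκs' Fi hLi hFi hbari)
    (covLa214M2b_TransportFanCeiling_of_kernelPair_S2hub hΛ h8 h0 hz d hd enc Bkey dΛ f hf sp hsp o ho EB
      THo hHo TEo hEo TXo hXo μo νo κo capo κo' flo Ko Qo γo wvo hsho go hgo SYo CWo hcwo AVo hRo βo hβo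
      THh hHh TEh hEh TXh hXh μh νh κh caph κh' flh Kh Qh γh wvh hshh gh hgh SYh CWh hcwh AVh hRh βh hβh
      hκo hκo' hκh hκh' Fo Lo hLodef hLo hFo hbaro)

end Leaf

end Summit.Ventures.CertifiedManyBodySolver.Theorems

end
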